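import Mathlib.RingTheory.Frobenius
import Mathlib.RingTheory.Invariant.Galois
import Mathlib.NumberTheory.NumberField.Basic
import Mathlib.NumberTheory.NumberField.Norm
import Mathlib.RingTheory.Ideal.Norm.AbsNorm
import Mathlib.FieldTheory.IsAlgClosed.Basic
import Mathlib.Analysis.Complex.Polynomial.Basic
import Mathlib.RingTheory.Coprime.Lemmas
import Literature.NumberTheory.EllipticCurves.ModularPolynomialKronecker
import HarnessLib

/-!
# Algebraic numbers linked by a polynomial satisfying Kronecker's congruence are conjugate
# (the Frobenius argument of Cox, *Primes of the form x² + ny²*, §11.D, (11.30)–(11.33))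

Topic `NumberTheory/EllipticCurves` (complex multiplication).  This file isolates the algebraic-number-
theoretic half of the proof that all singular moduli of a given discriminant are conjugate over `ℚ`
(the class-equation form of the "First Main Theorem", Cox §13.A), in a form that does not mention
lattices or modular functions:

* **`minpoly_eq_of_modularLink`.**  Let `S ⊂ ℂ` be a finite set of algebraic numbers.  There is a
  finite set of primes `badPrimes S` such that for every prime `ℓ ∉ badPrimes S` and every
  `Φ ∈ ℤ[Y][X]` with `Φ ≡ (X^ℓ − Y)(X − Y^ℓ) mod ℓ` (coefficientwise), any `r, r' ∈ S` with
  `Φ(r', r) = 0` have the same minimal polynomial over `ℚ`.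

Applied with `Φ = Φ_ℓ` the modular equation (`ModularPolynomialIntegral.lean`: `Φ_ℓ ∈ ℤ[X, Y]`,
Kronecker's congruence `dvd_coeff_coeff_intModularPolynomial_sub`, and `Φ_ℓ(j(ℓτ), j(τ)) = 0`), it says
that `j`-invariants of lattices `Λ' ⊂ Λ` of prime index `ℓ` (off a finite set) are conjugate — which,
chained along sublattices, gives the conjugacy of all `j(𝔞)`, `𝔞 ∈ C(𝒪)`, without class field theory.

## The argument (Cox pp. 246–248, Deuring's proof of Thm. 11.1, rearranged)

With `L = ℚ(all conjugates of S) ⊂ ℂ` (`conjField`, Galois over `ℚ`, a number field), `T ⊂ L` the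
finite Galois-stable set of roots of `∏_{s∈S} minpoly(s)` (`conjRoots`), `N₀` a common denominator
(`denomT`, so that `y(t) = N₀t ∈ 𝓞 L`, `intElt`), `Δ = ∏_{t ≠ t'} (y(t) − y(t'))` (`discElt`, Cox
(11.31)) and `badPrimes S = {ℓ ∣ N₀} ∪ {ℓ ∣ N(Δ)}`:
1. take a prime `𝔓 ∋ ℓ` of `𝓞 L` (`exists_isMaximal_natCast_mem`; `𝓞 L/𝔓` has characteristic `ℓ`,
   `charP_quotient_of_natCast_mem`) and a Frobenius `σ` at `𝔓`, `σ x ≡ x^ℓ mod 𝔓` (Mathlib's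
   `arithFrobAt` for `Aut(𝓞 L / ℤ)`, `Algebra.isInvariant_of_isGalois'`; (11.30), (11.33));
2. homogenise `Φ(r', r) = 0` to `Σ c_{m,i} N₀^{D−m−i} y^i y'^m = 0` in `𝓞 L` (`homogSum`,
   `homogSum_mul_mul`) and reduce mod `𝔓`: by Kronecker's congruence and `N₀^ℓ ≡ N₀` this is
   `N₀^{D−ℓ−1}(y' − y^ℓ)(y'^ℓ − y) ≡ 0` (`homogSum_congr_of_dvd`, `homogSum_kroneckerRHS`), whence
   `y' ≡ y^ℓ` or `y'^ℓ ≡ y` — Cox's (11.32);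
3. so `y' ≡ σ(y)` or `y' ≡ σ⁻¹(y) mod 𝔓` (Frobenius, injectivity of `x ↦ x^ℓ` on the residue field);
   `σ^{±1}(y(t)) = y(σ_L^{±1} t)` for the corresponding `σ_L ∈ Gal(L/ℚ)` (`aut_intElt`, via
   `galRestrict`), and distinct elements of `T` remain distinct mod `𝔓` because `ℓ ∤ N(Δ)`
   (`eq_of_intElt_sub_mem`; Cox: "then `p` and `Δ` would not be relatively prime");
4. hence `t' = σ_L^{±1} t` and `minpoly r' = minpoly r`.

Cox runs this with `Φ_p` for `p` split in the order and completes Thm. 11.1 with class field theory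
(the characterisation of the ring class field by the primes it splits); the present file keeps only the
elementary nucleus.  Everything is proved; definitions: `evalXY`, `homogSum`, `conjPoly`, `conjField`,
`conjRoots`, `denomT`, `intElt`, `discElt`, `badPrimes`.

## Mathlib / tree search

Mathlib (pin of the tree) supplies the Frobenius machinery (`IsArithFrobAt`, `arithFrobAt`,
`IsArithFrobAt.exists_of_isInvariant`, `Algebra.isInvariant_of_isGalois'`, `galRestrict`,
`algebraMap_galRestrict_apply`), `Ideal.absNorm`, `IsAlgebraic.exists_nsmul_eq`; the tree's
`GaloisRepresentations/FrobeniusPlaces.lean` works at the level of absolute Galois groups and is not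
needed here.  `lean search` for `modularLink`, `conjField`, `Kronecker congruence conjugate`: nothing.
Design note: `L` is taken inside `ℂ` as `IntermediateField.adjoin ℚ (rootSet)` rather than as a
`SplittingField` (whose second `ℚ`-algebra structure defeats instance search for `Normal`).

## References

* D. A. Cox, *Primes of the form x² + ny²*, 2nd ed., Wiley 2013, §11.C Thm. 11.18 (v), §11.D proof of
  Thm. 11.1 (PDF pp. 246–248 of the held copy), (11.30)–(11.33). [Cox2013]
* M. Deuring, *Die Klassenkörper der komplexen Multiplikation*, Enzyklopädie Math. Wiss. I.2.23 (1958),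
  §10 (the proof Cox follows).
-/

noncomputable section

open Polynomial NumberField

namespace Literature.NumberTheory.EllipticCurves

/-! ### Evaluating bivariate integer polynomials, and the homogenised evaluation -/

/-- `Φ(x, y)` for `Φ ∈ ℤ[Y][X]` (outer variable `X ↦ x`, inner `Y ↦ y`) in a commutative ring.
[folklore] -/
def evalXY (Φ : Polynomial (Polynomial ℤ)) {A : Type*} [CommRing A] (x y : A) : A :=
  ((Φ.map (mapRingHom (Int.castRingHom A))).map (evalRingHom y)).eval x

/-- `Φ(x, y) = Σ_{m<RX} Σ_{i<RY} c_{m,i} yⁱ xᵐ` for any bounds `RX > deg_X Φ`, `RY > deg_Y`. [folklore] -/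
lemma evalXY_eq_sum (Φ : Polynomial (Polynomial ℤ)) {A : Type*} [CommRing A] (x y : A) {RX RY : ℕ}
    (hRX : Φ.natDegree < RX) (hRY : ∀ m, (Φ.coeff m).natDegree < RY) :
    evalXY Φ x y = ∑ m ∈ Finset.range RX, ∑ i ∈ Finset.range RY, ((Φ.coeff m).coeff i : A) * y ^ i * x ^ m := by
  rw [evalXY, eval_eq_sum_range' (n := RX)]
  · refine Finset.sum_congr rfl fun m _ ↦ ?_
    rw [Polynomial.coeff_map, Polynomial.coeff_map, coe_mapRingHom, coe_evalRingHom, eval_eq_sum_range' (n := RY),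
      Finset.sum_mul]
    · refine Finset.sum_congr rfl fun i _ ↦ ?_
      rw [Polynomial.coeff_map, eq_intCast]
    · exact lt_of_le_of_lt (natDegree_map_le) (hRY m)
  · refine lt_of_le_of_lt (natDegree_map_le.trans natDegree_map_le) hRX

/-- `evalXY` is natural in the ring. [folklore] -/
lemma map_evalXY (Φ : Polynomial (Polynomial ℤ)) {A B : Type*} [CommRing A] [CommRing B] (f : A →+* B) (x y : A) :
    f (evalXY Φ x y) = evalXY Φ (f x) (f y) := by
  have hhom : (f.comp (evalRingHom y)).comp (mapRingHom (Int.castRingHom A)) =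
      (evalRingHom (f y)).comp (mapRingHom (Int.castRingHom B)) := by
    refine Polynomial.ringHom_ext' (RingHom.ext_int _ _) ?_
    simp
  unfold evalXY
  rw [← eval₂_id, hom_eval₂, RingHom.comp_id, eval₂_eq_eval_map, Polynomial.map_map, Polynomial.map_map, hhom,
    Polynomial.map_map]

/-- The **homogenised evaluation** `Σ_{m<RX} Σ_{i<RY} c_{m,i} N^{D−m−i} yⁱ xᵐ` of `Φ = Σ c_{m,i} Yⁱ Xᵐ`:
for `D` large, `N^D Φ(x, y) = (this sum at (N x, N y))`, so that it can be evaluated at the integral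
elements `N r'`, `N r` when `r, r'` are merely algebraic. [folklore] -/
def homogSum (Φ : Polynomial (Polynomial ℤ)) (RX RY D : ℕ) {A : Type*} [CommRing A] (N x y : A) : A :=
  ∑ m ∈ Finset.range RX, ∑ i ∈ Finset.range RY, ((Φ.coeff m).coeff i : A) * N ^ (D - m - i) * y ^ i * x ^ m

/-- `homogSum` is natural in the ring. [folklore] -/
lemma map_homogSum (Φ : Polynomial (Polynomial ℤ)) (RX RY D : ℕ) {A B : Type*} [CommRing A] [CommRing B]
    (f : A →+* B) (N x y : A) : f (homogSum Φ RX RY D N x y) = homogSum Φ RX RY D (f N) (f x) (f y) := by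
  simp only [homogSum, map_sum, map_mul, map_pow, map_intCast]

/-- **Homogenisation**: `(homogSum Φ)(N; N x, N y) = N^D Φ(x, y)` when `RX`, `RY` bound the degrees and
`RX + RY ≤ D + 2`. [folklore] -/
lemma homogSum_mul_mul (Φ : Polynomial (Polynomial ℤ)) {RX RY D : ℕ} {A : Type*} [CommRing A] (N x y : A)
    (hRX : Φ.natDegree < RX) (hRY : ∀ m, (Φ.coeff m).natDegree < RY) (hD : RX + RY ≤ D + 2) :
    homogSum Φ RX RY D N (N * x) (N * y) = N ^ D * evalXY Φ x y := by
  rw [homogSum, evalXY_eq_sum Φ x y hRX hRY, Finset.mul_sum]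
  refine Finset.sum_congr rfl fun m hm ↦ ?_
  rw [Finset.mul_sum]
  refine Finset.sum_congr rfl fun i hi ↦ ?_
  have hm' := Finset.mem_range.mp hm
  have hi' := Finset.mem_range.mp hi
  have hexp : D - m - i + i + m = D := by omega
  calc ((Φ.coeff m).coeff i : A) * N ^ (D - m - i) * (N * y) ^ i * (N * x) ^ m
      = ((Φ.coeff m).coeff i : A) * (N ^ (D - m - i) * N ^ i * N ^ m) * y ^ i * x ^ m := by ring
    _ = N ^ D * (((Φ.coeff m).coeff i : A) * y ^ i * x ^ m) := by rw [← pow_add, ← pow_add, hexp]; ring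

/-- In characteristic `ℓ`, congruent coefficients give equal homogenised sums. [folklore] -/
lemma homogSum_congr_of_dvd {Φ Ψ : Polynomial (Polynomial ℤ)} {ℓ : ℕ}
    (h : ∀ m i, (ℓ : ℤ) ∣ ((Φ - Ψ).coeff m).coeff i) (RX RY D : ℕ) {A : Type*} [CommRing A] [CharP A ℓ]
    (N x y : A) : homogSum Φ RX RY D N x y = homogSum Ψ RX RY D N x y := by
  unfold homogSum
  refine Finset.sum_congr rfl fun m _ ↦ Finset.sum_congr rfl fun i _ ↦ ?_
  congr 3
  rw [← sub_eq_zero, ← Int.cast_sub, CharP.intCast_eq_zero_iff A ℓ, ← Polynomial.coeff_sub, ← Polynomial.coeff_sub]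
  exact h m i

/-- A double sum against the Kronecker-delta table of `(X^ℓ − Y)(X − Y^ℓ)` collapses to four terms. [folklore] -/
lemma sum_sum_kroneckerTable {A : Type*} [AddCommGroup A] {ℓ RX RY : ℕ} (hRX : ℓ + 1 < RX) (hRY : ℓ + 1 < RY)
    (g : ℕ → ℕ → A) :
    ∑ m ∈ Finset.range RX, ∑ i ∈ Finset.range RY,
        (((if m = ℓ + 1 ∧ i = 0 then 1 else 0) - (if m = ℓ ∧ i = ℓ then 1 else 0) -
          (if m = 1 ∧ i = 1 then 1 else 0) + (if m = 0 ∧ i = ℓ + 1 then 1 else 0) : ℤ)) • g m i =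
      g (ℓ + 1) 0 - g ℓ ℓ - g 1 1 + g 0 (ℓ + 1) := by
  have key : ∀ a b : ℕ, a < RX → b < RY →
      ∑ m ∈ Finset.range RX, ∑ i ∈ Finset.range RY, ((if m = a ∧ i = b then 1 else 0 : ℤ)) • g m i = g a b := by
    intro a b ha hb
    rw [Finset.sum_eq_single a, Finset.sum_eq_single b]
    · simp
    · intro i _ hi; simp [hi]
    · intro h; exact absurd (Finset.mem_range.mpr hb) h
    · intro m _ hm; simp [hm]
    · intro h; exact absurd (Finset.mem_range.mpr ha) h
  simp only [add_smul, sub_smul, Finset.sum_add_distrib, Finset.sum_sub_distrib]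
  rw [key _ _ hRX (by omega), key _ _ (by omega) (by omega), key _ _ (by omega) (by omega), key _ _ (by omega) hRY]

/-- **The homogenised Kronecker right-hand side**: for `n^{ℓ−1} = 1` (Fermat) and `D ≥ 2ℓ`,
`homogSum ((X^ℓ − Y)(X − Y^ℓ)) (n; x, y) = n^{D−ℓ−1} (x − y^ℓ)(x^ℓ − y)` (Cox (11.32):
"`(j(𝔞')^p − j(𝔞))(j(𝔞') − j(𝔞)^p)`"). [cite: Cox2013, §11.D (11.32)] -/
lemma homogSum_kroneckerRHS {ℓ RX RY D : ℕ} (hRX : ℓ + 1 < RX) (hRY : ℓ + 1 < RY) (hD : 2 * ℓ ≤ D) (hℓ : 1 ≤ ℓ)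
    {A : Type*} [CommRing A] (n x y : A) (hn : n ^ (ℓ - 1) = 1) :
    homogSum (kroneckerRHS ℓ ℤ) RX RY D n x y = n ^ (D - (ℓ + 1)) * ((x - y ^ ℓ) * (x ^ ℓ - y)) := by
  unfold homogSum
  simp_rw [coeff_coeff_kroneckerRHS]
  have h := sum_sum_kroneckerTable hRX hRY (fun m i ↦ (n ^ (D - m - i) * y ^ i * x ^ m : A))
  simp only [zsmul_eq_mul, Int.cast_add, Int.cast_sub, Int.cast_ite, Int.cast_one, Int.cast_zero] at h
  rw [show ∑ m ∈ Finset.range RX, ∑ i ∈ Finset.range RY,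
      ((((if m = ℓ + 1 ∧ i = 0 then 1 else 0) - (if m = ℓ ∧ i = ℓ then 1 else 0) -
        (if m = 1 ∧ i = 1 then 1 else 0) + (if m = 0 ∧ i = ℓ + 1 then 1 else 0) : ℤ) : A)) *
          n ^ (D - m - i) * y ^ i * x ^ m =
      ∑ m ∈ Finset.range RX, ∑ i ∈ Finset.range RY,
        ((((if m = ℓ + 1 ∧ i = 0 then 1 else 0) - (if m = ℓ ∧ i = ℓ then 1 else 0) -
          (if m = 1 ∧ i = 1 then 1 else 0) + (if m = 0 ∧ i = ℓ + 1 then 1 else 0) : ℤ) : A)) *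
            (n ^ (D - m - i) * y ^ i * x ^ m) by simp_rw [mul_assoc]]
  push_cast at h ⊢
  rw [h]
  -- exponent bookkeeping with `n^{ℓ−1} = 1`
  have e1 : n ^ (D - ℓ - ℓ) = n ^ (D - (ℓ + 1)) := by
    rw [show D - (ℓ + 1) = (D - ℓ - ℓ) + (ℓ - 1) by omega, pow_add, hn, mul_one]
  have e2 : n ^ (D - 1 - 1) = n ^ (D - (ℓ + 1)) := by
    rw [show D - 1 - 1 = (D - (ℓ + 1)) + (ℓ - 1) by omega, pow_add, hn, mul_one]
  simp only [Nat.sub_zero, pow_zero, mul_one, pow_one, show D - (ℓ + 1) - 0 = D - (ℓ + 1) by omega, e1, e2]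
  ring

/-! ### The number field generated by the conjugates of a finite set of algebraic numbers -/

section NumberFieldSetup

open IntermediateField

variable (S : Finset ℂ)

/-- `H₀ = ∏_{s ∈ S} minpoly_ℚ(s)`. [folklore] -/
def conjPoly : ℚ[X] := ∏ s ∈ S, minpoly ℚ s

/-- The field `L = ℚ(all complex roots of H₀) ⊂ ℂ`, a Galois number field containing `S`
(Cox works in "`L`, Galois over `ℚ`", §11.D). [cite: Cox2013, §11.D proof of Thm. 11.1] -/
def conjField : IntermediateField ℚ ℂ := IntermediateField.adjoin ℚ ((conjPoly S).rootSet ℂ)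

variable {S}

/-- `H₀ ≠ 0` when all elements of `S` are algebraic. [folklore] -/
lemma conjPoly_ne_zero (hS : ∀ s ∈ S, IsIntegral ℚ s) : conjPoly S ≠ 0 :=
  Finset.prod_ne_zero_iff.mpr fun s hs ↦ minpoly.ne_zero (hS s hs)

/-- Every `s ∈ S` is a root of `H₀`. [folklore] -/
lemma aeval_conjPoly_eq_zero {s : ℂ} (hs : s ∈ S) : aeval s (conjPoly S) = 0 := by
  rw [conjPoly, map_prod]
  exact Finset.prod_eq_zero hs (minpoly.aeval ℚ s)

/-- `S ⊆ L`. [folklore] -/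
lemma mem_conjField (hS : ∀ s ∈ S, IsIntegral ℚ s) {s : ℂ} (hs : s ∈ S) : s ∈ conjField S :=
  IntermediateField.subset_adjoin _ _ (mem_rootSet.mpr ⟨conjPoly_ne_zero hS, aeval_conjPoly_eq_zero hs⟩)

/-- `L/ℚ` is finite. [folklore] -/
instance finiteDimensional_conjField : FiniteDimensional ℚ (conjField S) := by
  unfold conjField
  haveI : Finite ((conjPoly S).rootSet ℂ) := (rootSet_finite (conjPoly S) ℂ).to_subtype
  exact IntermediateField.finiteDimensional_adjoin fun x hx ↦ (isAlgebraic_of_mem_rootSet hx).isIntegral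

/-- `L/ℚ` is normal (a splitting field of `H₀`). [folklore] -/
instance normal_conjField : Normal ℚ (conjField S) :=
  Normal.of_isSplittingField (p := conjPoly S)
    (hFEp := IntermediateField.adjoin_rootSet_isSplittingField (IsAlgClosed.splits _))

/-- `L/ℚ` is Galois. [folklore] -/
instance isGalois_conjField : IsGalois ℚ (conjField S) := IsGalois.mk

/-- `L` is a number field. [folklore] -/
instance numberField_conjField : NumberField (conjField S) := NumberField.mk

/-- The finite, Galois-stable set `T ⊂ L` of the roots of `H₀` (all conjugates of all elements of `S`). [folklore] -/
def conjRoots : Finset (conjField S) := ((conjPoly S).rootSet (conjField S)).toFinset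

/-- Membership in `T`. [folklore] -/
lemma mem_conjRoots (hS : ∀ s ∈ S, IsIntegral ℚ s) {t : conjField S} :
    t ∈ conjRoots (S := S) ↔ aeval t (conjPoly S) = 0 := by
  rw [conjRoots, Set.mem_toFinset, mem_rootSet]
  exact ⟨fun h ↦ h.2, fun h ↦ ⟨conjPoly_ne_zero hS, h⟩⟩

/-- Elements of `L` lying in `S` belong to `T`. [folklore] -/
lemma mem_conjRoots_of_coe_mem (hS : ∀ s ∈ S, IsIntegral ℚ s) {t : conjField S} (ht : (t : ℂ) ∈ S) :
    t ∈ conjRoots (S := S) := by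
  rw [mem_conjRoots hS]
  apply Subtype.val_injective
  rw [show ((aeval t (conjPoly S) : conjField S) : ℂ) = aeval (t : ℂ) (conjPoly S) from
    (aeval_algHom_apply (conjField S).val _ _).symm]
  simpa using aeval_conjPoly_eq_zero ht

/-- `T` is stable under `Gal(L/ℚ)`. [folklore] -/
lemma algEquiv_mem_conjRoots (hS : ∀ s ∈ S, IsIntegral ℚ s) (σ : (conjField S) ≃ₐ[ℚ] (conjField S))
    {t : conjField S} (ht : t ∈ conjRoots (S := S)) : σ t ∈ conjRoots (S := S) := by
  rw [mem_conjRoots hS] at ht ⊢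
  rw [show σ t = (σ : conjField S →ₐ[ℚ] conjField S) t from rfl, aeval_algHom_apply, ht, map_zero]

/-- **A common denominator**: `N₀ ≠ 0` with `N₀ t` an algebraic integer for every `t ∈ T` (Cox assumes the
`j(𝔞)` integral outright, via `Φ_m(X, X)`; for merely algebraic numbers we clear denominators).
[folklore] -/
lemma exists_mul_mem_ringOfIntegers :
    ∃ N : ℕ, N ≠ 0 ∧ ∀ t ∈ conjRoots (S := S), IsIntegral ℤ ((N : conjField S) * t) := by
  haveI : Algebra.IsAlgebraic ℤ ℚ := IsLocalization.isAlgebraic ℚ (nonZeroDivisors ℤ)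
  have h : ∀ t : conjField S, ∃ n : ℕ, n ≠ 0 ∧ IsIntegral ℤ ((n : conjField S) * t) := by
    intro t
    have halg : IsAlgebraic ℤ t :=
      IsAlgebraic.restrictScalars ℤ (Algebra.IsAlgebraic.isAlgebraic (R := ℚ) t)
    obtain ⟨m, s, hm, hs⟩ := IsAlgebraic.exists_nsmul_eq (S := 𝓞 (conjField S)) halg
    refine ⟨m, hm, ?_⟩
    rw [← nsmul_eq_mul, hs]
    exact (s.2 : IsIntegral ℤ (s : conjField S))
  choose n hn hint using h
  refine ⟨∏ t ∈ conjRoots (S := S), n t, Finset.prod_ne_zero_iff.mpr fun t _ ↦ hn t, fun t ht ↦ ?_⟩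
  obtain ⟨k, hk⟩ := Finset.dvd_prod_of_mem n ht
  rw [hk, Nat.cast_mul, mul_comm ((n t : ℕ) : conjField S), mul_assoc, ← nsmul_eq_mul]
  exact (hint t).nsmul k

variable (S)

/-- The common denominator `N₀` of `exists_mul_mem_ringOfIntegers`. [folklore] -/
def denomT : ℕ := Classical.choose (exists_mul_mem_ringOfIntegers (S := S))

/-- `N₀ ≠ 0`. [folklore] -/
lemma denomT_ne_zero : denomT S ≠ 0 := (Classical.choose_spec (exists_mul_mem_ringOfIntegers (S := S))).1

variable {S}

/-- `N₀ t` is an algebraic integer for `t ∈ T`. [folklore] -/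
lemma isIntegral_denomT_mul {t : conjField S} (ht : t ∈ conjRoots (S := S)) :
    IsIntegral ℤ ((denomT S : conjField S) * t) :=
  (Classical.choose_spec (exists_mul_mem_ringOfIntegers (S := S))).2 t ht

/-- The algebraic integers `y(t) = N₀ t ∈ 𝓞 L` (`t ∈ T`; junk value `0` off `T`). [folklore] -/
def intElt (t : conjField S) : 𝓞 (conjField S) :=
  if ht : t ∈ conjRoots (S := S) then ⟨(denomT S : conjField S) * t, isIntegral_denomT_mul ht⟩ else 0

/-- Value of `y(t)` in `L`. [folklore] -/
lemma coe_intElt {t : conjField S} (ht : t ∈ conjRoots (S := S)) :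
    (intElt t : conjField S) = (denomT S : conjField S) * t := by
  rw [intElt, dif_pos ht]; rfl

/-- `y` is injective on `T`. [folklore] -/
lemma intElt_injOn {t₁ t₂ : conjField S} (h₁ : t₁ ∈ conjRoots (S := S)) (h₂ : t₂ ∈ conjRoots (S := S))
    (h : intElt t₁ = intElt t₂) : t₁ = t₂ := by
  have := congrArg (fun x : 𝓞 (conjField S) ↦ (x : conjField S)) h
  simp only [coe_intElt h₁, coe_intElt h₂] at this
  exact mul_left_cancel₀ (Nat.cast_ne_zero.mpr (denomT_ne_zero S)) this

variable (S)

/-- The discriminant-like product `Δ = ∏_{t ≠ t' ∈ T} (y(t) − y(t')) ∈ 𝓞 L` (Cox (11.31):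
`Δ = ∏_{i<j} (j(𝔞ᵢ) − j(𝔞ⱼ))`). [cite: Cox2013, §11.D (11.31)] -/
def discElt : 𝓞 (conjField S) := ∏ q ∈ (conjRoots (S := S)).offDiag, (intElt q.1 - intElt q.2)

/-- `Δ ≠ 0` ("a nonzero element of `𝒪_L`", Cox after (11.31)). [cite: Cox2013, §11.D (11.31)] -/
lemma discElt_ne_zero : discElt S ≠ 0 := by
  rw [discElt, Finset.prod_ne_zero_iff]
  intro q hq
  rw [Finset.mem_offDiag] at hq
  exact sub_ne_zero.mpr fun h ↦ hq.2.2 (intElt_injOn hq.1 hq.2.1 h)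

/-- **The finite set of bad primes**: those dividing `N₀`, and those below a prime of `𝓞 L` containing
`Δ` (Cox: "We may assume that `p` is relatively prime to `Δ`"; also `p ∤` the denominators).
[cite: Cox2013, §11.D proof of Thm. 11.1 (after (11.31))] -/
def badPrimes : Finset ℕ := (denomT S).primeFactors ∪ (Ideal.absNorm (Ideal.span {discElt S})).primeFactors

variable {S}

/-! ### Primes of `𝓞 L` above `ℓ` -/

/-- A rational prime `ℓ` is not a unit in `𝓞 K` (`1/ℓ` is not an algebraic integer). [folklore] -/
lemma not_isUnit_natCast_ringOfIntegers {K : Type*} [Field K] [NumberField K] {ℓ : ℕ} (hℓ : ℓ.Prime) :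
    ¬ IsUnit ((ℓ : ℕ) : 𝓞 K) := by
  rintro ⟨u, hu⟩
  -- `u⁻¹ = 1/ℓ` is an algebraic integer
  have h1 : ((ℓ : ℕ) : 𝓞 K) * ↑u⁻¹ = 1 := by rw [← hu]; exact u.mul_inv
  have h2 := congrArg (algebraMap (𝓞 K) K) h1
  rw [map_mul, map_one, map_natCast] at h2
  have hinv : algebraMap (𝓞 K) K ↑u⁻¹ = (ℓ : K)⁻¹ := eq_inv_of_mul_eq_one_right h2
  have hint : IsIntegral ℤ ((ℓ : K)⁻¹) := by
    rw [← hinv, ← RingOfIntegers.coe_eq_algebraMap]; exact RingOfIntegers.isIntegral_coe _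
  have hint' : IsIntegral ℤ ((ℓ : ℚ)⁻¹) := by
    rw [← isIntegral_algebraMap_iff (algebraMap ℚ K).injective]
    simpa using hint
  obtain ⟨m, hm⟩ := IsIntegrallyClosed.isIntegral_iff.mp hint'
  have hm' : (m : ℚ) * ℓ = 1 := by
    rw [show ((m : ℤ) : ℚ) = (algebraMap ℤ ℚ) m from rfl, hm, inv_mul_cancel₀ (Nat.cast_ne_zero.mpr hℓ.ne_zero)]
  have hdvd : (ℓ : ℤ) ∣ 1 := ⟨m, by exact_mod_cast (by linarith [hm'] : (1 : ℚ) = ℓ * m)⟩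
  have := Int.eq_one_of_dvd_one (by positivity) hdvd
  have := hℓ.one_lt
  omega

end NumberFieldSetup

section PrimeAbove

variable {K : Type*} [Field K] [NumberField K] {ℓ : ℕ}

/-- There is a maximal ideal of `𝓞 K` containing the rational prime `ℓ`. [folklore] -/
lemma exists_isMaximal_natCast_mem (hℓ : ℓ.Prime) : ∃ 𝔓 : Ideal (𝓞 K), 𝔓.IsMaximal ∧ ((ℓ : ℕ) : 𝓞 K) ∈ 𝔓 := by
  obtain ⟨𝔓, hmax, hle⟩ := Ideal.exists_le_maximal (Ideal.span {((ℓ : ℕ) : 𝓞 K)})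
    (fun h ↦ not_isUnit_natCast_ringOfIntegers hℓ (Ideal.span_singleton_eq_top.mp h))
  exact ⟨𝔓, hmax, hle (Ideal.subset_span (Set.mem_singleton _))⟩

variable {𝔓 : Ideal (𝓞 K)}

omit [NumberField K] in
/-- For a proper ideal `𝔓 ∋ ℓ`: `n ∈ 𝔓 ↔ ℓ ∣ n` for natural numbers `n` (`𝔓 ∩ ℤ = ℓℤ`). [folklore] -/
lemma natCast_mem_iff_dvd (hℓ : ℓ.Prime) (hℓ𝔓 : ((ℓ : ℕ) : 𝓞 K) ∈ 𝔓) (h𝔓 : 𝔓 ≠ ⊤) (n : ℕ) :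
    ((n : ℕ) : 𝓞 K) ∈ 𝔓 ↔ ℓ ∣ n := by
  constructor
  · intro hn
    by_contra hnd
    have hcop : Nat.Coprime ℓ n := (Nat.Prime.coprime_iff_not_dvd hℓ).mpr hnd
    apply h𝔓
    rw [Ideal.eq_top_iff_one]
    obtain ⟨a, b, hab⟩ := Nat.isCoprime_iff_coprime.mpr hcop
    have h := congrArg (Int.cast : ℤ → 𝓞 K) hab
    push_cast at h
    rw [← h]
    exact 𝔓.add_mem (𝔓.mul_mem_left _ hℓ𝔓) (𝔓.mul_mem_left _ hn)
  · rintro ⟨k, rfl⟩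
    rw [Nat.cast_mul]
    exact 𝔓.mul_mem_right _ hℓ𝔓

omit [NumberField K] in
/-- **`𝓞 K / 𝔓` has characteristic `ℓ`** for a proper ideal `𝔓 ∋ ℓ`. [folklore] -/
lemma charP_quotient_of_natCast_mem (hℓ : ℓ.Prime) (hℓ𝔓 : ((ℓ : ℕ) : 𝓞 K) ∈ 𝔓) (h𝔓 : 𝔓 ≠ ⊤) :
    CharP (𝓞 K ⧸ 𝔓) ℓ := by
  refine CharP.mk fun n ↦ ?_
  rw [← map_natCast (Ideal.Quotient.mk 𝔓), Ideal.Quotient.eq_zero_iff_mem]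
  exact natCast_mem_iff_dvd hℓ hℓ𝔓 h𝔓 n

omit [NumberField K] in
/-- The prime of `ℤ` under a proper ideal `𝔓 ∋ ℓ` is `(ℓ)`. [folklore] -/
lemma under_int_eq_span (hℓ : ℓ.Prime) (hℓ𝔓 : ((ℓ : ℕ) : 𝓞 K) ∈ 𝔓) (h𝔓 : 𝔓 ≠ ⊤) :
    𝔓.under ℤ = Ideal.span {(ℓ : ℤ)} := by
  have hmax : (Ideal.span {(ℓ : ℤ)}).IsMaximal :=
    PrincipalIdealRing.isMaximal_of_irreducible (Int.prime_iff_natAbs_prime.mpr (by simpa using hℓ)).irreducible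
  refine (hmax.eq_of_le ?_ ?_).symm
  · intro h
    apply h𝔓
    rw [Ideal.eq_top_iff_one] at h ⊢
    simpa using (Ideal.mem_comap.mp h)
  · rw [Ideal.span_le, Set.singleton_subset_iff]
    show (algebraMap ℤ (𝓞 K)) (ℓ : ℤ) ∈ 𝔓
    simpa using hℓ𝔓

omit [NumberField K] in
/-- `#(ℤ / (𝔓 ∩ ℤ)) = ℓ`. [folklore] -/
lemma natCard_int_quot_under (hℓ : ℓ.Prime) (hℓ𝔓 : ((ℓ : ℕ) : 𝓞 K) ∈ 𝔓) (h𝔓 : 𝔓 ≠ ⊤) :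
    Nat.card (ℤ ⧸ 𝔓.under ℤ) = ℓ := by
  rw [under_int_eq_span hℓ hℓ𝔓 h𝔓, Nat.card_congr (Int.quotientSpanNatEquivZMod ℓ).toEquiv, Nat.card_zmod]

/-- A proper ideal containing `ℓ` is nonzero. [folklore] -/
lemma ne_bot_of_natCast_mem (hℓ : ℓ.Prime) (hℓ𝔓 : ((ℓ : ℕ) : 𝓞 K) ∈ 𝔓) : 𝔓 ≠ ⊥ := by
  intro h
  rw [h, Ideal.mem_bot] at hℓ𝔓
  exact hℓ.ne_zero (Nat.cast_eq_zero.mp hℓ𝔓)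

/-- **`ℓ` divides the norm of every proper ideal containing `ℓ`** (its norm is a power of `ℓ`). [folklore] -/
lemma dvd_absNorm_of_natCast_mem (hℓ : ℓ.Prime) (hℓ𝔓 : ((ℓ : ℕ) : 𝓞 K) ∈ 𝔓) (h𝔓 : 𝔓 ≠ ⊤) : ℓ ∣ Ideal.absNorm 𝔓 := by
  have h1 : Ideal.absNorm 𝔓 ∣ Ideal.absNorm (Ideal.span {((ℓ : ℕ) : 𝓞 K)}) :=
    Ideal.absNorm_dvd_absNorm_of_le ((Ideal.span_singleton_le_iff_mem _).mpr hℓ𝔓)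
  rw [Ideal.absNorm_span_singleton, show ((ℓ : ℕ) : 𝓞 K) = algebraMap ℤ (𝓞 K) (ℓ : ℤ) by simp,
    Algebra.norm_algebraMap, Int.natAbs_pow, Int.natAbs_natCast] at h1
  obtain ⟨k, hk, hk'⟩ := (Nat.dvd_prime_pow hℓ).mp h1
  have hk0 : k ≠ 0 := by
    rintro rfl
    rw [pow_zero, Ideal.absNorm_eq_one_iff] at hk'
    exact h𝔓 hk'
  rw [hk']
  exact dvd_pow_self ℓ hk0

/-- If `x ∈ 𝔓` then `ℓ` divides the norm of `(x)`. [folklore] -/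
lemma dvd_absNorm_span_of_mem (hℓ : ℓ.Prime) (hℓ𝔓 : ((ℓ : ℕ) : 𝓞 K) ∈ 𝔓) (h𝔓 : 𝔓 ≠ ⊤) {x : 𝓞 K} (hx : x ∈ 𝔓) :
    ℓ ∣ Ideal.absNorm (Ideal.span {x}) :=
  (dvd_absNorm_of_natCast_mem hℓ hℓ𝔓 h𝔓).trans
    (Ideal.absNorm_dvd_absNorm_of_le ((Ideal.span_singleton_le_iff_mem _).mpr hx))

end PrimeAbove





/-! ### The main theorem: a modular link at a good prime forces conjugacy -/

section Main

open IntermediateField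

variable {S : Finset ℂ}

/-- Degree bookkeeping for the homogenised sum. [folklore] -/
lemma natDegree_coeff_lt_sup (Φ : Polynomial (Polynomial ℤ)) (m k : ℕ) :
    (Φ.coeff m).natDegree < (Finset.range (Φ.natDegree + 1)).sup (fun m ↦ (Φ.coeff m).natDegree) + k + 1 := by
  by_cases hm : m ≤ Φ.natDegree
  · have : (Φ.coeff m).natDegree ≤ (Finset.range (Φ.natDegree + 1)).sup (fun m ↦ (Φ.coeff m).natDegree) :=
      Finset.le_sup (f := fun m ↦ (Φ.coeff m).natDegree) (Finset.mem_range.mpr (Nat.lt_succ_of_le hm))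
    omega
  · rw [Polynomial.coeff_eq_zero_of_natDegree_lt (not_le.mp hm), natDegree_zero]
    omega

set_option maxHeartbeats 400000 in
/-- `Δ = (y(u) − y(v)) · (rest)` for distinct `u, v ∈ T`. [folklore] -/
lemma discElt_eq_mul {u v : conjField S} (hu : u ∈ conjRoots (S := S)) (hv : v ∈ conjRoots (S := S))
    (hne : u ≠ v) : discElt S = (intElt u - intElt v) *
      ∏ q ∈ ((conjRoots (S := S)).offDiag).erase (u, v), (intElt q.1 - intElt q.2) := by
  rw [discElt]
  exact (Finset.mul_prod_erase ((conjRoots (S := S)).offDiag) (fun q ↦ intElt q.1 - intElt q.2)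
    (a := (u, v)) (Finset.mem_offDiag.mpr ⟨hu, hv, hne⟩)).symm

/-- **Separation** (Cox: "`j(𝔞) − j(𝔞')` would be one of the factors of `Δ` … and `p` and `Δ` would not be
relatively prime"): for a good prime `ℓ` and a proper ideal `𝔓 ∋ ℓ`, distinct elements of `T` stay distinct
modulo `𝔓`. [cite: Cox2013, §11.D proof of Thm. 11.1 (after (11.33))] -/
lemma eq_of_intElt_sub_mem {ℓ : ℕ} (hℓ : ℓ.Prime) (hbad : ℓ ∉ badPrimes S) {𝔓 : Ideal (𝓞 (conjField S))}
    (hℓ𝔓 : ((ℓ : ℕ) : 𝓞 (conjField S)) ∈ 𝔓) (h𝔓top : 𝔓 ≠ ⊤) {u v : conjField S}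
    (hu : u ∈ conjRoots (S := S)) (hv : v ∈ conjRoots (S := S)) (h : intElt u - intElt v ∈ 𝔓) : u = v := by
  by_contra hne
  have hΔ : discElt S ∈ 𝔓 := by rw [discElt_eq_mul hu hv hne]; exact 𝔓.mul_mem_right _ h
  have h1 := dvd_absNorm_span_of_mem hℓ hℓ𝔓 h𝔓top hΔ
  have h2 : Ideal.absNorm (Ideal.span {discElt S}) ≠ 0 := by
    rw [Ne, Ideal.absNorm_eq_zero_iff, Ideal.span_singleton_eq_bot]
    exact discElt_ne_zero S
  exact hbad (Finset.mem_union_right _ (Nat.mem_primeFactors.mpr ⟨hℓ, h1, h2⟩))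

/-- **Galois compatibility**: an automorphism `τ` of `𝓞 L` acts on `y(u) = N₀u` through the corresponding
element `τ_L ∈ Gal(L/ℚ)`: `τ(y(u)) = y(τ_L u)`, and `τ_L u ∈ T`. [folklore] -/
lemma aut_intElt (hS : ∀ s ∈ S, IsIntegral ℚ s) (τ : 𝓞 (conjField S) ≃ₐ[ℤ] 𝓞 (conjField S)) {u : conjField S}
    (hu : u ∈ conjRoots (S := S)) :
    τ (intElt u) = intElt ((galRestrict ℤ ℚ (conjField S) (𝓞 (conjField S))).symm τ u) ∧
      (galRestrict ℤ ℚ (conjField S) (𝓞 (conjField S))).symm τ u ∈ conjRoots (S := S) := by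
  obtain ⟨τL, rfl⟩ : ∃ τL : conjField S ≃ₐ[ℚ] conjField S,
      galRestrict ℤ ℚ (conjField S) (𝓞 (conjField S)) τL = τ := ⟨_, MulEquiv.apply_symm_apply _ τ⟩
  rw [MulEquiv.symm_apply_apply]
  have hmem := algEquiv_mem_conjRoots hS τL hu
  refine ⟨?_, hmem⟩
  apply FaithfulSMul.algebraMap_injective (𝓞 (conjField S)) (conjField S)
  rw [algebraMap_galRestrict_apply ℤ τL (intElt u), ← RingOfIntegers.coe_eq_algebraMap,
    ← RingOfIntegers.coe_eq_algebraMap, coe_intElt hu, coe_intElt hmem, map_mul, map_natCast]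

/-- **Conjugacy from a modular link at a good prime** (the Frobenius argument of Cox §11.D,
(11.30)–(11.33), run for an arbitrary `Φ ∈ ℤ[Y][X]` satisfying Kronecker's congruence mod `ℓ`).
Let `S ⊂ ℂ` be a finite set of algebraic numbers.  For every prime `ℓ` outside the finite set
`badPrimes S` and every `Φ ≡ (X^ℓ − Y)(X − Y^ℓ) mod ℓ`: if `r, r' ∈ S` satisfy `Φ(r', r) = 0`, then
`r'` and `r` are conjugate over `ℚ` (same minimal polynomial).  Proof: in `L = ℚ(conjugates) ⊂ ℂ`
with `𝔓 ∣ ℓ` a prime of `𝓞 L` and `σ` a Frobenius at `𝔓`, Kronecker gives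
`(y' − y^ℓ)(y'^ℓ − y) ∈ 𝔓` for `y = N₀r`, `y' = N₀r'` ((11.32)), Frobenius gives `σy ≡ y^ℓ` ((11.30),
(11.33)), so `y' ≡ σ^{±1} y mod 𝔓`, and distinct conjugates stay distinct mod `𝔓` since `ℓ ∤ Δ`
((11.31)). [cite: Cox2013, §11.D proof of Thm. 11.1, (11.30)–(11.33)] -/
theorem minpoly_eq_of_modularLink (hS : ∀ s ∈ S, IsIntegral ℚ s) {ℓ : ℕ} (hℓ : ℓ.Prime)
    (hbad : ℓ ∉ badPrimes S) (Φ : Polynomial (Polynomial ℤ))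
    (hΦ : ∀ m i, (ℓ : ℤ) ∣ ((Φ - kroneckerRHS ℓ ℤ).coeff m).coeff i)
    {r r' : ℂ} (hr : r ∈ S) (hr' : r' ∈ S) (hlink : evalXY Φ r' r = 0) : minpoly ℚ r' = minpoly ℚ r := by
  haveI : Fact ℓ.Prime := ⟨hℓ⟩
  -- the two elements of `T`
  obtain ⟨t, rfl⟩ : ∃ t : conjField S, (t : ℂ) = r := ⟨⟨r, mem_conjField hS hr⟩, rfl⟩
  obtain ⟨t', rfl⟩ : ∃ t' : conjField S, (t' : ℂ) = r' := ⟨⟨r', mem_conjField hS hr'⟩, rfl⟩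
  have ht : t ∈ conjRoots (S := S) := mem_conjRoots_of_coe_mem hS hr
  have ht' : t' ∈ conjRoots (S := S) := mem_conjRoots_of_coe_mem hS hr'
  -- a prime `𝔓 ∣ ℓ` of `𝓞 L` and its residue field
  obtain ⟨𝔓, hmax, hℓ𝔓⟩ := exists_isMaximal_natCast_mem (K := conjField S) hℓ
  have h𝔓top : 𝔓 ≠ ⊤ := hmax.ne_top
  haveI : 𝔓.IsMaximal := hmax
  haveI : CharP (𝓞 (conjField S) ⧸ 𝔓) ℓ := charP_quotient_of_natCast_mem hℓ hℓ𝔓 h𝔓top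
  -- `N₀` is a unit mod `𝔓`
  have hN : ¬ ℓ ∣ denomT S := fun h ↦
    hbad (Finset.mem_union_left _ (Nat.mem_primeFactors.mpr ⟨hℓ, h, denomT_ne_zero S⟩))
  have hn0 : ((denomT S : ℕ) : 𝓞 (conjField S) ⧸ 𝔓) ≠ 0 := by
    rw [Ne, CharP.cast_eq_zero_iff (𝓞 (conjField S) ⧸ 𝔓) ℓ]; exact hN
  have hnpow : ((denomT S : ℕ) : 𝓞 (conjField S) ⧸ 𝔓) ^ (ℓ - 1) = 1 := by
    have h := map_natCast (frobenius (𝓞 (conjField S) ⧸ 𝔓) ℓ) (denomT S)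
    rw [frobenius_def] at h
    have h2 : ((denomT S : ℕ) : 𝓞 (conjField S) ⧸ 𝔓) ^ (ℓ - 1) * (denomT S : 𝓞 (conjField S) ⧸ 𝔓) =
        1 * (denomT S : 𝓞 (conjField S) ⧸ 𝔓) := by
      rw [← pow_succ, Nat.sub_add_cancel hℓ.one_lt.le, h, one_mul]
    exact mul_right_cancel₀ hn0 h2
  -- degree bounds and the homogenised relation in `𝓞 L`
  obtain ⟨RX, hRX, hRXℓ⟩ : ∃ RX, Φ.natDegree < RX ∧ ℓ + 1 < RX := ⟨Φ.natDegree + ℓ + 2, by omega, by omega⟩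
  obtain ⟨RY, hRY, hRYℓ⟩ : ∃ RY, (∀ m, (Φ.coeff m).natDegree < RY) ∧ ℓ + 1 < RY :=
    ⟨(Finset.range (Φ.natDegree + 1)).sup (fun m ↦ (Φ.coeff m).natDegree) + ℓ + 2,
      fun m ↦ by have := natDegree_coeff_lt_sup Φ m (ℓ + 1); omega, by omega⟩
  obtain ⟨D, hD, hDℓ⟩ : ∃ D, RX + RY ≤ D + 2 ∧ 2 * ℓ ≤ D := ⟨RX + RY, by omega, by omega⟩
  have key : homogSum Φ RX RY D ((denomT S : ℕ) : 𝓞 (conjField S)) (intElt t') (intElt t) = 0 := by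
    have hinj : Function.Injective ((conjField S).val.toRingHom.comp (algebraMap (𝓞 (conjField S)) (conjField S))) :=
      Subtype.val_injective.comp (FaithfulSMul.algebraMap_injective (𝓞 (conjField S)) (conjField S))
    apply hinj
    rw [map_homogSum, map_zero]
    have e1 : ((conjField S).val.toRingHom.comp (algebraMap (𝓞 (conjField S)) (conjField S))) (intElt t') =
        (denomT S : ℂ) * (t' : ℂ) := by
      show ((intElt t' : conjField S) : ℂ) = _
      rw [coe_intElt ht']; rfl
    have e2 : ((conjField S).val.toRingHom.comp (algebraMap (𝓞 (conjField S)) (conjField S))) (intElt t) =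
        (denomT S : ℂ) * (t : ℂ) := by
      show ((intElt t : conjField S) : ℂ) = _
      rw [coe_intElt ht]; rfl
    rw [e1, e2, map_natCast, homogSum_mul_mul Φ _ _ _ hRX hRY hD, hlink, mul_zero]
  -- reduce modulo `𝔓`: Kronecker
  have hF : homogSum Φ RX RY D (Ideal.Quotient.mk 𝔓 (denomT S : 𝓞 (conjField S)))
      (Ideal.Quotient.mk 𝔓 (intElt t')) (Ideal.Quotient.mk 𝔓 (intElt t)) = 0 := by
    rw [← map_homogSum, key, map_zero]
  rw [map_natCast, homogSum_congr_of_dvd hΦ, homogSum_kroneckerRHS hRXℓ hRYℓ hDℓ hℓ.one_lt.le _ _ _ hnpow,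
    mul_eq_zero] at hF
  have hprod : (Ideal.Quotient.mk 𝔓 (intElt t') - Ideal.Quotient.mk 𝔓 (intElt t) ^ ℓ) *
      (Ideal.Quotient.mk 𝔓 (intElt t') ^ ℓ - Ideal.Quotient.mk 𝔓 (intElt t)) = 0 :=
    hF.resolve_left (pow_ne_zero _ hn0)
  -- a Frobenius element at `𝔓`
  haveI : Finite (𝓞 (conjField S) ≃ₐ[ℤ] 𝓞 (conjField S)) :=
    Finite.of_equiv _ (galRestrict ℤ ℚ (conjField S) (𝓞 (conjField S))).toEquiv
  haveI : Algebra.IsInvariant ℤ (𝓞 (conjField S)) (𝓞 (conjField S) ≃ₐ[ℤ] 𝓞 (conjField S)) :=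
    Algebra.isInvariant_of_isGalois' ℤ ℚ (conjField S) (𝓞 (conjField S))
  haveI : Finite (𝓞 (conjField S) ⧸ 𝔓) := Ideal.finiteQuotientOfFreeOfNeBot 𝔓 (ne_bot_of_natCast_mem hℓ hℓ𝔓)
  obtain ⟨σ, hσ⟩ : ∃ σ : 𝓞 (conjField S) ≃ₐ[ℤ] 𝓞 (conjField S), IsArithFrobAt ℤ σ 𝔓 :=
    ⟨_, IsArithFrobAt.arithFrobAt ℤ (𝓞 (conjField S) ≃ₐ[ℤ] 𝓞 (conjField S)) 𝔓⟩
  have hFrob : ∀ x : 𝓞 (conjField S), Ideal.Quotient.mk 𝔓 (σ x) = Ideal.Quotient.mk 𝔓 x ^ ℓ := fun x ↦ by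
    have h := hσ x
    rw [MulSemiringAction.toAlgHom_apply, AlgEquiv.smul_def, natCard_int_quot_under hℓ hℓ𝔓 h𝔓top,
      ← Ideal.Quotient.eq] at h
    rw [h, map_pow]
  -- Galois compatibility and separation
  have hgal := fun (τ : 𝓞 (conjField S) ≃ₐ[ℤ] 𝓞 (conjField S)) ↦ aut_intElt hS τ ht
  have hsep : ∀ {v : conjField S}, v ∈ conjRoots (S := S) → intElt t' - intElt v ∈ 𝔓 → t' = v :=
    fun hv h ↦ eq_of_intElt_sub_mem hℓ hbad hℓ𝔓 h𝔓top ht' hv h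
  -- conclusion from `t' = τ t` for some `τ ∈ Gal(L/ℚ)`
  have hconcl : ∀ τL : conjField S ≃ₐ[ℚ] conjField S, t' = τL t → minpoly ℚ (t' : ℂ) = minpoly ℚ (t : ℂ) := by
    intro τL h
    have e1 : minpoly ℚ (t' : ℂ) = minpoly ℚ t' := minpoly.algHom_eq (conjField S).val Subtype.val_injective t'
    have e2 : minpoly ℚ (t : ℂ) = minpoly ℚ t := minpoly.algHom_eq (conjField S).val Subtype.val_injective t
    rw [e1, e2, h, minpoly.algEquiv_eq]
  -- the two cases of (11.32)
  rcases mul_eq_zero.mp hprod with hA | hB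
  · -- `y' ≡ y^ℓ ≡ σ y`
    have h1 : intElt t' - σ (intElt t) ∈ 𝔓 := by
      rw [← Ideal.Quotient.eq, hFrob]; exact sub_eq_zero.mp hA
    obtain ⟨hστ, hmem⟩ := hgal σ
    rw [hστ] at h1
    exact hconcl _ (hsep hmem h1)
  · -- `y'^ℓ ≡ y ≡ (σ⁻¹ y)^ℓ`, hence `y' ≡ σ⁻¹ y`
    have hz : σ (σ⁻¹ (intElt t)) = intElt t := AlgEquiv.apply_symm_apply σ _
    have h2 : Ideal.Quotient.mk 𝔓 (intElt t) = Ideal.Quotient.mk 𝔓 (σ⁻¹ (intElt t)) ^ ℓ := by rw [← hFrob, hz]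
    have h3 : Ideal.Quotient.mk 𝔓 (intElt t') ^ ℓ = Ideal.Quotient.mk 𝔓 (σ⁻¹ (intElt t)) ^ ℓ := by
      rw [← h2]; exact sub_eq_zero.mp hB
    have h4 : Ideal.Quotient.mk 𝔓 (intElt t') = Ideal.Quotient.mk 𝔓 (σ⁻¹ (intElt t)) := by
      rw [← frobenius_def, ← frobenius_def] at h3
      exact frobenius_inj (𝓞 (conjField S) ⧸ 𝔓) ℓ h3
    have h5 : intElt t' - σ⁻¹ (intElt t) ∈ 𝔓 := Ideal.Quotient.eq.mp h4
    obtain ⟨hστ, hmem⟩ := hgal σ⁻¹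
    rw [hστ] at h5
    exact hconcl _ (hsep hmem h5)

end Main

end Literature.NumberTheory.EllipticCurves

end
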